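import Summits.CriticalPhenomena.CardyFormulaZ2.Theorems.CardyIKTransportIKLinearTransportStubConditionalRSWGlue
import Summits.CriticalPhenomena.CardyFormulaZ2.Theorems.CardyIKTransportIKLinearTransportStubCouplingToLimitsEvents
import Summits.CriticalPhenomena.CardyFormulaZ2.Theorems.CardyIKTransportIKMixedBoxCrossingStubDuality

/-!
# Line `pinned-diagram-exchange` of crux `CardyIKTransport.IKLinearTransport` (stmt-CriticalPhenomena-5076):
# `stub_ConditionalRSW` from SCREENING + the route crux r4 (reshape v8 of the lead, glue only)

Theorem-only support file (`--supports stmt-CriticalPhenomena-5076`, registered sub-goal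
`conditionalRSW_of_screening`). The lead's skeleton v8 replaces the registered research stub
`stub_ConditionalRSW : ∃ c, 0 < c ∧ ∀ S n, 1 ≤ n → ∀ a b E, MeasurableSet E → CondRSWBound c S n a b E`
(conditional RSW, uniform in the column pattern and in the far conditioning) by two registered stubs and
this glue:

* `stub_MixedRSW` := the route decl `Theses.CardyIKTransport.IKMixedBoxCrossing` itself (crux r4,
  stmt-CriticalPhenomena-5911: UNCONDITIONAL long-way crossings of the `2n × n` / `n × 2n` boxes, uniformly in
  `S`, scale and position) — read in the line's vocabulary by `mixedRSW_of_IKMixedBoxCrossing` (the landed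
  definitional bridge `iff_cbox_transport` of the stmt-5911 line plus `(νmix S).real L = μIK.real (obs S ⁻¹' L)`);
* `stub_Screening` — FAR-FIELD RATIO WEAK MIXING of the gauge colour field: for every `ε > 0` there is `N`
  such that for `n ≥ N`, every `S`, every `w × h` box with `w, h ≤ 2n`, every measurable far event `E`
  (determined by the cells at sup-distance `> n`... `≥ n` from the box, `farFrom a b w h n`) and every
  measurable box event `L`: `|ν_S(E ∩ L) − ν_S(E) ν_S(L)| ≤ ε ν_S(E)` (the plaquette array between the box
  and the far region screens the far conditioning at rate `(7 − 4√3)^n`; an `𝔽₂`-Fourier computation);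
* `conditionalRSW_of_screening` (here, sorry-free): with `ε := c/2` the long-way crossing (`lrCross`, a box
  event: `lrCross_mem_determinedOn`) keeps conditional probability `≥ c/2` under every far conditioning at
  all scales `n ≥ N`; the scales below `N` are the landed finite-energy theorem
  (`stub_ConditionalRSW_of_largeScales`, p88076).

Also here: the box-locality of crossing events (`openCrossing_congr_of_box`, `lrCross_mem_determinedOn`,
`tbCross_mem_determinedOn`), used by the screening files. Theorem-only (no definitions).
-/

noncomputable section

namespace Summit.CriticalPhenomena.CardyFormulaZ2.Theorems.IKLinearTransport.PinnedDiagramExchange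

open scoped Classical
open MeasureTheory Set
open Literature.Probability.Percolation Literature.Probability.LatticeModels
open Summit.CriticalPhenomena.CardyFormulaZ2.Cruxes.IKMixedBoxCrossing.PairedMirrorExploration
  (pLR pTB iff_cbox_transport)
open Summit.CriticalPhenomena.CardyFormulaZ2.Cruxes.IKMixedBoxCrossing.PairedMirrorExploration.DualityStub
  (measurableSet_lrCross measurableSet_tbCross)

/-! ## §1 Box-locality of crossing events -/

/-- An open crossing inside `X` reads only the edges with both endpoints in `X`. [folklore] -/
theorem openCrossing_congr_of_box {V : Type*} {X A B : Set V} {K K' : BondConfig V}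
    (h : ∀ u ∈ X, ∀ v ∈ X, (s(u, v) ∈ K ↔ s(u, v) ∈ K')) :
    K ∈ openCrossing X A B ↔ K' ∈ openCrossing X A B := by
  have hG : (openGraph K).induce X = (openGraph K').induce X := by
    ext ⟨u, hu⟩ ⟨v, hv⟩
    simp only [SimpleGraph.comap_adj, Function.Embedding.coe_subtype, openGraph_adj, h u hu v hv]
  simp only [mem_openCrossing_iff, openConnIn, Set.mem_setOf_eq, hG]

/-- One direction of the edge-locality of `blackEdges`: if two observable configurations agree on the
cells and faces of a cell set `Q` closed under "the face below an anti-diagonal edge", a black edge of the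
first between two cells of `Q` is a black edge of the second. [folklore] -/
theorem mk_mem_blackEdges_of_agree {Q : Set (Site 2)} (hQ : ∀ u ∈ Q, u + ![1, -1] ∈ Q → u + ![0, -1] ∈ Q)
    {x y : Obs} (hxy : ∀ v ∈ Q, (v ∈ x.1 ↔ v ∈ y.1) ∧ (v ∈ x.2 ↔ v ∈ y.2))
    {u v : Site 2} (hu : u ∈ Q) (hv : v ∈ Q) (he : s(u, v) ∈ blackEdges x) : s(u, v) ∈ blackEdges y := by
  obtain ⟨u', v', he', hu', hv', hR⟩ := he
  have hmem : u' ∈ Q ∧ v' ∈ Q := by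
    rcases Sym2.eq_iff.1 he' with ⟨rfl, rfl⟩ | ⟨rfl, rfl⟩
    · exact ⟨hu, hv⟩
    · exact ⟨hv, hu⟩
  refine ⟨u', v', he', (hxy u' hmem.1).1.1 hu', (hxy v' hmem.2).1.1 hv', ?_⟩
  rcases hR with h1 | h2 | ⟨h3, h3'⟩ | ⟨h4, h4'⟩
  · exact Or.inl h1
  · exact Or.inr (Or.inl h2)
  · exact Or.inr (Or.inr (Or.inl ⟨h3, fun h => h3' ((hxy u' hmem.1).2.2 h)⟩))
  · exact Or.inr (Or.inr (Or.inr ⟨h4, ((hxy _ (hQ u' hmem.1 (h4 ▸ hmem.2))).2).1 h4'⟩))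

/-- `blackEdges` agreement on such a cell set. [folklore] -/
theorem mk_mem_blackEdges_iff_of_agree {Q : Set (Site 2)} (hQ : ∀ u ∈ Q, u + ![1, -1] ∈ Q → u + ![0, -1] ∈ Q)
    {x y : Obs} (hxy : ∀ v ∈ Q, (v ∈ x.1 ↔ v ∈ y.1) ∧ (v ∈ x.2 ↔ v ∈ y.2))
    {u v : Site 2} (hu : u ∈ Q) (hv : v ∈ Q) : s(u, v) ∈ blackEdges x ↔ s(u, v) ∈ blackEdges y :=
  ⟨mk_mem_blackEdges_of_agree hQ hxy hu hv,
    mk_mem_blackEdges_of_agree hQ (fun v hv' => ⟨(hxy v hv').1.symm, (hxy v hv').2.symm⟩) hu hv⟩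

/-- A cell box is closed under "the face below an anti-diagonal edge". [folklore] -/
theorem box_face_closed (a b : ℤ) (w h : ℕ) :
    ∀ u ∈ {v : Site 2 | a ≤ v 0 ∧ v 0 < a + w ∧ b ≤ v 1 ∧ v 1 < b + h},
      u + ![1, -1] ∈ {v : Site 2 | a ≤ v 0 ∧ v 0 < a + w ∧ b ≤ v 1 ∧ v 1 < b + h} →
      u + ![0, -1] ∈ {v : Site 2 | a ≤ v 0 ∧ v 0 < a + w ∧ b ≤ v 1 ∧ v 1 < b + h} := by
  intro u hu hv
  simp only [Set.mem_setOf_eq, Pi.add_apply, Matrix.cons_val_zero, Matrix.cons_val_one,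
    Matrix.cons_val_fin_one] at hu hv ⊢
  omega

/-- The black LR crossing of a box is determined by the cells and faces of the box. [folklore] -/
theorem lrCross_mem_determinedOn (a b : ℤ) (w h : ℕ) :
    lrCross a b w h ∈ determinedOn {v : Site 2 | a ≤ v 0 ∧ v 0 < a + w ∧ b ≤ v 1 ∧ v 1 < b + h} := by
  intro x y hxy
  exact openCrossing_congr_of_box fun u hu v hv =>
    mk_mem_blackEdges_iff_of_agree (box_face_closed a b w h) hxy hu hv

/-- The black TB crossing of a box is determined by the cells and faces of the box. [folklore] -/
theorem tbCross_mem_determinedOn (a b : ℤ) (w h : ℕ) :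
    tbCross a b w h ∈ determinedOn {v : Site 2 | a ≤ v 0 ∧ v 0 < a + w ∧ b ≤ v 1 ∧ v 1 < b + h} := by
  intro x y hxy
  exact openCrossing_congr_of_box fun u hu v hv =>
    mk_mem_blackEdges_iff_of_agree (box_face_closed a b w h) hxy hu hv

/-! ## §2 The route crux r4 in the line's vocabulary -/

/-- `ν_S(L) = μIK(obs S ⁻¹' L)` for measurable `L`. [folklore] -/
theorem nuMix_real_eq (S : Set ℤ) {L : Set Obs} (hL : MeasurableSet L) :
    (νmix S).real L = μIK.real (obs S ⁻¹' L) :=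
  map_measureReal_apply (CouplingToLimits.measurable_obs S) hL

/-- MIXED RSW IN THE LINE'S VOCABULARY from the route crux r4 `IKMixedBoxCrossing` (stmt-5911): uniform
long-way crossings of the `2n × n` and `n × 2n` boxes under `ν_S`, every `S`, scale and position. [folklore] -/
theorem mixedRSW_of_IKMixedBoxCrossing
    (h : Summit.CriticalPhenomena.CardyFormulaZ2.Theses.CardyIKTransport.IKMixedBoxCrossing) :
    ∃ c : ℝ, 0 < c ∧ ∀ (S : Set ℤ) (n : ℕ), 1 ≤ n → ∀ (a b : ℤ),
      c ≤ (νmix S).real (lrCross a b (2 * n) n) ∧ c ≤ (νmix S).real (tbCross a b n (2 * n)) := by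
  obtain ⟨c, hc, hbox⟩ := iff_cbox_transport.1 h
  refine ⟨c, hc, fun S n hn a b => ?_⟩
  rw [nuMix_real_eq S (measurableSet_lrCross _ _ _ _), nuMix_real_eq S (measurableSet_tbCross _ _ _ _)]
  exact hbox S n hn a b

/-! ## §3 The glue: conditional RSW from screening -/

/-- One box, one direction: a long-way crossing of probability `≥ c` and screening with `ε = c/2` give the
conditional bound `c/2 · ν(E) ≤ ν(E ∩ L)`. [folklore] -/
theorem cond_of_screening_one {ν : Measure Obs} {E L : Set Obs} {c : ℝ}
    (hL : c ≤ ν.real L) (hscr : |ν.real (E ∩ L) - ν.real E * ν.real L| ≤ c / 2 * ν.real E) :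
    c / 2 * ν.real E ≤ ν.real (E ∩ L) := by
  have hE : 0 ≤ ν.real E := measureReal_nonneg
  have h1 : ν.real E * ν.real L - c / 2 * ν.real E ≤ ν.real (E ∩ L) := by
    have := (abs_le.1 hscr).1
    linarith
  nlinarith

/-- **CONDITIONAL RSW FROM SCREENING** (registered sub-goal; the v8 reshape of `stub_ConditionalRSW`):
the route crux r4 `IKMixedBoxCrossing` (stmt-5911, as the registered `stub_MixedRSW`) and far-field ratio
weak mixing of the gauge colour field (the registered `stub_Screening`) imply the registered signature of
`stub_ConditionalRSW` verbatim — large scales by screening with `ε = c/2`, small scales by the landed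
finite-energy theorem `stub_ConditionalRSW_of_largeScales`. [folklore] -/
theorem conditionalRSW_of_screening :
    Summit.CriticalPhenomena.CardyFormulaZ2.Theses.CardyIKTransport.IKMixedBoxCrossing →
    (∀ ε : ℝ, 0 < ε → ∃ N : ℕ, ∀ (S : Set ℤ) (n : ℕ), N ≤ n → ∀ (a b : ℤ) (w h : ℕ),
      w ≤ 2 * n → h ≤ 2 * n → ∀ (E L : Set Obs), MeasurableSet E → MeasurableSet L →
      E ∈ determinedOn (farFrom a b w h n) →
      L ∈ determinedOn {v : Site 2 | a ≤ v 0 ∧ v 0 < a + w ∧ b ≤ v 1 ∧ v 1 < b + h} →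
      |(νmix S).real (E ∩ L) - (νmix S).real E * (νmix S).real L| ≤ ε * (νmix S).real E) →
    ∃ c : ℝ, 0 < c ∧ ∀ (S : Set ℤ) (n : ℕ), 1 ≤ n → ∀ (a b : ℤ) (E : Set Obs), MeasurableSet E →
      CondRSWBound c S n a b E := by
  intro hM hS
  obtain ⟨c, hc, hbox⟩ := mixedRSW_of_IKMixedBoxCrossing hM
  obtain ⟨N, hN⟩ := hS (c / 2) (half_pos hc)
  refine stub_ConditionalRSW_of_largeScales N (half_pos hc) fun S n hNn hn a b E hE =>
    ⟨fun hdet => ?_, fun hdet => ?_⟩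
  · have hw : 2 * n ≤ 2 * n := le_rfl
    have hh : n ≤ 2 * n := by omega
    exact cond_of_screening_one (hbox S n hn a b).1
      (hN S n hNn a b (2 * n) n hw hh E _ hE (measurableSet_lrCross _ _ _ _) hdet
        (lrCross_mem_determinedOn a b (2 * n) n))
  · have hw : n ≤ 2 * n := by omega
    have hh : 2 * n ≤ 2 * n := le_rfl
    exact cond_of_screening_one (hbox S n hn a b).2
      (hN S n hNn a b n (2 * n) hw hh E _ hE (measurableSet_tbCross _ _ _ _) hdet
        (tbCross_mem_determinedOn a b n (2 * n)))

end Summit.CriticalPhenomena.CardyFormulaZ2.Theorems.IKLinearTransport.PinnedDiagramExchange
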